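import Summits.BirchSwinnertonDyer.BirchSwinnertonDyer.Theorems.KolyvaginRoadThreeSchneiderTamAtThreeHeightLogNumeratorLargePrimeSeries
import Summits.BirchSwinnertonDyer.Uniform.UI.O2ScaleTranscendence
import HarnessLib

/-!
# «The height is the logarithm of the numerator» at a prime `p ≥ 5`, part B: the main theorem
# `‖x(P)·Σ²_E(P) − 1‖_p ≤ ‖x(P)‖_p⁻¹`

HONEST FRAMING (cell `bsd-stepL`, seat `bsd-stepL-tam3-p2` g0; `--supports stmt-BirchSwinnertonDyer-19154 --as helper`):
THEOREMS ONLY, unconditional, route-independent (no Theses import); 0 definitions, 0 named facts, 0 sorry;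
nothing here proves the crux `SchneiderTamAtThree` (a `p = 3` statement; parts 1–4 of this series treat
`p = 3`), Schneider's conjecture or BSD. This is the `p ≥ 5` companion — the same closed form at every
prime `p ≥ 5` of multiplicative reduction, where NO scale congruence is needed (`⅓`, `1/12` are
`p`-integral); consumer-in-waiting: the `p ≥ 5` REG-MULT ∕ REST universes of lane A (`bsd-stepL-reg3-eng`
v2 ∕ v3: 22 480 pairs, two kernel rungs), i.e. Schneider's binder `RegulatorNonvanishingAt W p` of the
lever at `p ≥ 5` (route ErratumRoadFive rows 19702 ∕ 19703).

* `norm_x_mul_tateSigmaValueSq_sub_one_le_padic` — for `p ≥ 5`, `W/ℚ` globally minimal with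
  multiplicative reduction at `p`, any `q ∈ ℚ_p` with `‖q‖_p < 1`, any rational `P = (x,y)` with
  `‖x‖_p > 1`: **`‖x·Σ²_E(P) − 1‖_p ≤ ‖x‖_p⁻¹`** (`x·Σ² ≡ 1 mod p^{2k}`, `p^{2k} ‖ den x`). Proof as at
  `p = 3` (part 3), steps (A)–(F), with step (D) trivial since `⅓(a₁²+a₂)` and `1/12` are `p`-units.
  PRE-REGISTERED CHECK: lane A's REG-MULT universe (kit j249895; 5 136 rows with point data,
  `p ∈ {3,5,7,11,13,17,23,29}`, split and non-split alike, formula (4.1)) obeys the consequent law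
  `v_p(ĥ_p(Q)) = v_p((num x)^{p−1} − 1)` if `< 2v_p(e(Q))`, else `≥ 2v_p(e(Q))`, in 5 136 / 5 136 rows.

References: [SteinWuthrich2013] §4.1 (4.1), §4.2; [SilvermanAEC2009] IV.1, IV.5–6, VII.2;
[Iwasawa1972PadicL] §4.4; ui-o2 `Uniform/UI/O2SigmaNormalisation.lean` (first order, any odd `p`),
`O2ScaleTranscendence.lean` (`‖C²‖_p = 1`).
-/

noncomputable section

open scoped Classical Nat
open Filter Topology IsUltrametricDist PowerSeries
open WeierstrassCurve Literature.NumberTheory.EllipticCurves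
open Literature.NumberTheory.EllipticCurves.SteinWuthrich2013
open Literature.NumberTheory.EllipticCurves.TateCurve
open Literature.NumberTheory.EllipticCurves.Rank1Residual
open Summit.BirchSwinnertonDyer.Uniform.UI.O2

namespace Summit.BirchSwinnertonDyer.Rank1Residual.X11b.RegMult.HeightLogNumerator

variable {p : ℕ} [hp : Fact p.Prime]

/-! ### §6′ MAIN THEOREM at a prime `p ≥ 5`: `x(P)·Σ²_E(P) ≡ 1 (mod p^{2k})`, `p^{2k} ‖ den x(P)` -/

section MainLarge

variable {W : WeierstrassCurve ℚ}

set_option maxHeartbeats 400000 in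
/-- **`‖x·Σ²_E(P) − 1‖_p ≤ ‖x‖_p⁻¹` at a prime `p ≥ 5` of multiplicative reduction** (`W/ℚ` globally
minimal, any `‖q‖_p < 1`, any rational `P = (x,y)` with `‖x‖_p > 1`). Same mechanism as the `p = 3`
theorem `norm_x_mul_tateSigmaValueSq_sub_one_le`, WITHOUT the scale congruence: for `p ≥ 5` the
coefficients `⅓(a₁²+a₂)` and `1/12` are `p`-integral, so every second-order term is `O(z²)` outright.
[cite: SteinWuthrich2013, §4.2] [cite: SilvermanAEC2009, IV.1, IV.6.4, VII.2.2] -/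
theorem norm_x_mul_tateSigmaValueSq_sub_one_le_padic (hp5 : 5 ≤ p) [W.IsElliptic] [W.IsGloballyMinimal]
    (hW : Mult W p) {q : ℚ_[p]} (hq : ‖q‖ < 1) {x y : ℚ} (hxy : W.toAffine.Nonsingular x y)
    (hx : 1 < ‖(x : ℚ_[p])‖) :
    ‖(x : ℚ_[p]) * tateSigmaValueSq W p q x y - 1‖ ≤ ‖(x : ℚ_[p])‖⁻¹ := by
  have hp2 : p ≠ 2 := by omega
  have hp3 : p ≠ 3 := by omega
  set X : ℚ_[p] := (x : ℚ_[p]) with hXdef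
  set Y : ℚ_[p] := (y : ℚ_[p]) with hYdef
  set V : WeierstrassCurve ℚ_[p] := W.baseChange ℚ_[p] with hVdef
  set z : ℚ_[p] := -X / Y with hzdef
  set ℓ : ℚ_[p] := V.padicFormalLog z with hℓdef
  set C2 : ℚ_[p] := uniformisationScaleSq W p q with hC2def
  set L : ℚ_[p] := logUnitParamSq W p q x y with hLdef
  set c : ℚ_[p] := coshOfSq L with hcdef
  set Pr : ℚ_[p] := ∏' n : ℕ, (1 - 2 * q ^ (n + 1) * c + q ^ (2 * (n + 1))) ^ 2 /
    (1 - q ^ (n + 1)) ^ 4 with hPrdef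
  have hSig : tateSigmaValueSq W p q x y = C2 * (2 * (c - 1) * Pr) := rfl
  have hL : L = ℓ ^ 2 / C2 := rfl
  -- the prime
  have hp1 : (1 : ℝ) < p := by exact_mod_cast hp.out.one_lt
  have hp0 : (0 : ℝ) < p := by positivity
  have hp5r : (5 : ℝ) ≤ p := by exact_mod_cast hp5
  -- basic norms
  obtain ⟨hz, hz2⟩ := norm_neg_div_of_one_lt_norm (p := p) hxy hx
  have hX0 : 0 < ‖X‖ := one_pos.trans hx
  have hX0' : X ≠ 0 := norm_pos_iff.mp hX0
  have hXz : ‖X‖ * ‖z‖ ^ 2 = 1 := by rw [hz2, mul_inv_cancel₀ hX0.ne']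
  have hXinv : ‖X‖⁻¹ = ‖z‖ ^ 2 := hz2.symm
  have hzz : 0 < ‖z‖ := by
    have h : 0 < ‖z‖ ^ 2 := by rw [hz2]; exact inv_pos.mpr hX0
    rcases (norm_nonneg z).eq_or_lt with h0 | h0
    · rw [← h0] at h; norm_num at h
    · exact h0
  -- small numeric facts about `r = ‖z‖ ∈ (0, 1/p]`, `p ≥ 5`
  have num : ∀ (P r : ℝ), 5 ≤ P → 0 < r → r ≤ P⁻¹ →
      r ≤ 1 ∧ P * r ≤ 1 ∧ r ^ 2 ≤ r ∧ r ^ 2 < r ∧ r ^ 2 ≤ 1 ∧ P ^ 2 * r ^ 2 ≤ 1 ∧ r ^ 2 ≤ (P⁻¹) ^ 2 := by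
    intro P r hP h0 hr
    have hP0 : 0 < P := by linarith
    have hPr : P * r ≤ 1 := by
      calc P * r ≤ P * P⁻¹ := by gcongr
        _ = 1 := mul_inv_cancel₀ hP0.ne'
    have hr1 : r ≤ 1 := by nlinarith
    have hP2 : P ^ 2 * r ^ 2 ≤ 1 := by
      rw [← mul_pow]; exact pow_le_one₀ (by positivity) hPr
    refine ⟨hr1, hPr, by nlinarith, by nlinarith, by nlinarith, hP2, ?_⟩
    exact pow_le_pow_left₀ h0.le hr 2
  obtain ⟨hz1, hpz, hz2le, hz2lt, hz2le1, hp2z, hzp2⟩ := num (p : ℝ) ‖z‖ hp5r hzz hz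
  obtain ⟨ha1, ha2, -, -, -⟩ := V.norm_coeffs_le_one
  have hC : ‖C2‖ = 1 := norm_uniformisationScaleSq_eq_one hW hq
  have hC0 : C2 ≠ 0 := norm_pos_iff.mp (by rw [hC]; exact one_pos)
  have heq : V.toAffine.Equation X Y := (nonsingular_ratCast (p := p) hxy).left
  obtain ⟨-, hxyn⟩ := V.norm_sq_eq_norm_cube heq hx
  have hY0 : Y ≠ 0 := by
    intro h; rw [h, norm_zero] at hxyn; linarith [norm_nonneg X]
  -- units `2, 3, 12` of `ℤ_p` (`p ≥ 5`)
  have hunit : ∀ m : ℕ, Nat.Coprime p m → ‖((m : ℚ_[p]))⁻¹‖ = 1 := fun m hm => by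
    rw [norm_inv, Padic.norm_natCast_eq_one_iff.mpr hm, inv_one]
  have hcop2 : Nat.Coprime p 2 := (Nat.coprime_primes hp.out Nat.prime_two).mpr hp2
  have hcop3 : Nat.Coprime p 3 := (Nat.coprime_primes hp.out Nat.prime_three).mpr hp3
  have h2n : ‖(2 : ℚ_[p])‖ = 1 := by simpa using Padic.norm_natCast_eq_one_iff.mpr hcop2
  have h2i : ‖(2 : ℚ_[p])⁻¹‖ = 1 := by simpa using hunit 2 hcop2
  have h3i : ‖(3 : ℚ_[p])⁻¹‖ = 1 := by simpa using hunit 3 hcop3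
  have h12i : ‖(12 : ℚ_[p])⁻¹‖ = 1 := by
    have h12 : Nat.Coprime p 12 := by
      rw [show (12 : ℕ) = 2 ^ 2 * 3 by norm_num]
      exact (Nat.Coprime.pow_right 2 hcop2).mul_right hcop3
    simpa using hunit 12 h12
  -- Step A: `X z² = 1 − a₁ z + ρ`, `‖ρ‖ ≤ ‖z‖²`
  set ρ : ℚ_[p] := X * z ^ 2 - 1 + V.a₁ * z with hρdef
  have hρ : ‖ρ‖ ≤ ‖z‖ ^ 2 := by
    have e : ρ = X ^ 3 / Y ^ 2 - 1 - V.a₁ * (X / Y) := by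
      rw [hρdef, hzdef]; field_simp; ring
    rw [e, ← hXinv]
    exact norm_pow_three_div_sq_sub_le_padic heq hx
  -- Step B: `ℓ = z + w`, `w = ½a₁z² + ⅓(a₁²+a₂)z³ + τ`, `‖τ‖ ≤ ‖z‖⁴`, `‖w‖ ≤ ‖z‖²`
  set B2 : ℚ_[p] := 2 * (3 : ℚ_[p])⁻¹ * (V.a₁ ^ 2 + V.a₂) with hB2def
  set τ : ℚ_[p] := ℓ - (z + (2 : ℚ_[p])⁻¹ * V.a₁ * z ^ 2 + (3 : ℚ_[p])⁻¹ * (V.a₁ ^ 2 + V.a₂) * z ^ 3)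
    with hτdef
  have hτ : ‖τ‖ ≤ ‖z‖ ^ 4 := norm_padicFormalLog_sub_cubic_le_pow_four_padic V hp5 hz
  set w : ℚ_[p] := ℓ - z with hwdef
  have hw_eq : w = (2 : ℚ_[p])⁻¹ * V.a₁ * z ^ 2 + (3 : ℚ_[p])⁻¹ * (V.a₁ ^ 2 + V.a₂) * z ^ 3 + τ := by
    rw [hwdef, hτdef]; ring
  have ha12 : ‖V.a₁ ^ 2 + V.a₂‖ ≤ 1 :=
    (norm_add_le_max _ _).trans (max_le (by rw [norm_pow]; exact pow_le_one₀ (norm_nonneg _) ha1) ha2)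
  have hB2 : ‖B2‖ ≤ 1 := by
    rw [hB2def, norm_mul, norm_mul, h2n, h3i, one_mul, one_mul]; exact ha12
  have hw : ‖w‖ ≤ ‖z‖ ^ 2 := by
    rw [hw_eq]
    refine (norm_add_le_max _ _).trans (max_le ((norm_add_le_max _ _).trans (max_le ?_ ?_)) ?_)
    · rw [norm_mul, norm_mul, h2i, one_mul, norm_pow]
      calc ‖V.a₁‖ * ‖z‖ ^ 2 ≤ 1 * ‖z‖ ^ 2 := by gcongr
        _ = ‖z‖ ^ 2 := one_mul _
    · rw [norm_mul, norm_mul, h3i, one_mul, norm_pow]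
      calc ‖V.a₁ ^ 2 + V.a₂‖ * ‖z‖ ^ 3 ≤ 1 * ‖z‖ ^ 3 := by gcongr
        _ = ‖z‖ * ‖z‖ ^ 2 := by ring
        _ ≤ 1 * ‖z‖ ^ 2 := by gcongr
        _ = ‖z‖ ^ 2 := one_mul _
    · calc ‖τ‖ ≤ ‖z‖ ^ 4 := hτ
        _ = ‖z‖ ^ 2 * ‖z‖ ^ 2 := by ring
        _ ≤ 1 * ‖z‖ ^ 2 := by gcongr
        _ = ‖z‖ ^ 2 := one_mul _
  have hℓzw : ℓ = z + w := by rw [hwdef]; ring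
  have hℓn : ‖ℓ‖ = ‖z‖ := by
    rw [hℓzw]
    have hlt : ‖w‖ < ‖z‖ := lt_of_le_of_lt hw hz2lt
    rw [norm_add_eq_max_of_norm_ne_norm hlt.ne', max_eq_left hlt.le]
  have hLn : ‖L‖ = ‖z‖ ^ 2 := by rw [hL, norm_div, norm_pow, hℓn, hC, div_one]
  have hLp : ‖L‖ ≤ ((p : ℝ)⁻¹) ^ 2 := by rw [hLn]; exact hzp2
  -- Step C: `X ℓ² = 1 + B2 z² + G`, `‖G‖ ≤ ‖z‖²`
  set G : ℚ_[p] := X * ℓ ^ 2 - 1 - B2 * z ^ 2 with hGdef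
  have hGid : G = ρ + (V.a₁ * z + B2 * z ^ 2) * (X * z ^ 2 - 1) + 2 * X * z * τ + X * w ^ 2 := by
    have hτw : τ = w - (2 : ℚ_[p])⁻¹ * V.a₁ * z ^ 2 - (3 : ℚ_[p])⁻¹ * (V.a₁ ^ 2 + V.a₂) * z ^ 3 := by
      rw [hw_eq]; ring
    rw [hGdef, hρdef, hτw, hℓzw, hB2def]
    ring
  have hXz1 : ‖X * z ^ 2 - 1‖ ≤ ‖z‖ := by
    rw [show X * z ^ 2 - 1 = ρ - V.a₁ * z by rw [hρdef]; ring]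
    refine (norm_sub_le_max₃ _ _).trans (max_le (hρ.trans hz2le) ?_)
    rw [norm_mul]
    calc ‖V.a₁‖ * ‖z‖ ≤ 1 * ‖z‖ := by gcongr
      _ = ‖z‖ := one_mul _
  have haB : ‖V.a₁ * z + B2 * z ^ 2‖ ≤ ‖z‖ := by
    refine (norm_add_le_max _ _).trans (max_le ?_ ?_)
    · rw [norm_mul]
      calc ‖V.a₁‖ * ‖z‖ ≤ 1 * ‖z‖ := by gcongr
        _ = ‖z‖ := one_mul _
    · rw [norm_mul, norm_pow]
      calc ‖B2‖ * ‖z‖ ^ 2 ≤ 1 * ‖z‖ ^ 2 := by gcongr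
        _ = ‖z‖ ^ 2 := one_mul _
        _ ≤ ‖z‖ := hz2le
  have hG : ‖G‖ ≤ ‖z‖ ^ 2 := by
    rw [hGid]
    refine (norm_add_le_max _ _).trans (max_le ((norm_add_le_max _ _).trans (max_le
      ((norm_add_le_max _ _).trans (max_le hρ ?_)) ?_)) ?_)
    · rw [norm_mul]
      calc ‖V.a₁ * z + B2 * z ^ 2‖ * ‖X * z ^ 2 - 1‖ ≤ ‖z‖ * ‖z‖ := by gcongr
        _ = ‖z‖ ^ 2 := by ring
    · rw [norm_mul, norm_mul, norm_mul, h2n, one_mul]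
      calc ‖X‖ * ‖z‖ * ‖τ‖ ≤ ‖X‖ * ‖z‖ * ‖z‖ ^ 4 := by gcongr
        _ = (‖X‖ * ‖z‖ ^ 2) * ‖z‖ * ‖z‖ ^ 2 := by ring
        _ = ‖z‖ * ‖z‖ ^ 2 := by rw [hXz, one_mul]
        _ ≤ 1 * ‖z‖ ^ 2 := by gcongr
        _ = ‖z‖ ^ 2 := one_mul _
    · rw [norm_mul, norm_pow]
      calc ‖X‖ * ‖w‖ ^ 2 ≤ ‖X‖ * (‖z‖ ^ 2) ^ 2 := by gcongr
        _ = (‖X‖ * ‖z‖ ^ 2) * ‖z‖ ^ 2 := by ring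
        _ = ‖z‖ ^ 2 := by rw [hXz, one_mul]
  -- Step D (trivial for `p ≥ 5`): `‖B2 z² + L/12‖ ≤ ‖z‖²`
  have hL12 : ‖L / 12‖ = ‖z‖ ^ 2 := by rw [div_eq_mul_inv, norm_mul, h12i, mul_one, hLn]
  have hK : ‖B2 * z ^ 2 + L / 12‖ ≤ ‖z‖ ^ 2 := by
    refine (norm_add_le_max _ _).trans (max_le ?_ hL12.le)
    rw [norm_mul, norm_pow]
    calc ‖B2‖ * ‖z‖ ^ 2 ≤ 1 * ‖z‖ ^ 2 := by gcongr
      _ = ‖z‖ ^ 2 := one_mul _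
  -- Step E: `cosh` to second order and `M = X·C2·2(c − 1)`
  set D : ℚ_[p] := 2 * (c - 1) - L - L ^ 2 / 12 with hDdef
  have hD : ‖D‖ ≤ (p : ℝ) ^ 2 * ‖L‖ ^ 3 := norm_two_mul_coshOfSq_sub_one_sub_sub_le_padic hp2 hLp
  set M : ℚ_[p] := X * C2 * (2 * (c - 1)) with hMdef
  have hMid : M - 1 = (B2 * z ^ 2 + L / 12) + (B2 * z ^ 2 + G) * (L / 12) + G + X * C2 * D := by
    have hCL : C2 * L = ℓ ^ 2 := by rw [hL]; field_simp
    have hXℓ : X * ℓ ^ 2 = 1 + B2 * z ^ 2 + G := by rw [hGdef]; ring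
    have h2c : 2 * (c - 1) = L + L ^ 2 / 12 + D := by rw [hDdef]; ring
    rw [hMdef, h2c]
    have : X * C2 * (L + L ^ 2 / 12 + D) = X * (C2 * L) * (1 + L / 12) + X * C2 * D := by ring
    rw [this, hCL, hXℓ]
    ring
  have hM1 : ‖M - 1‖ ≤ ‖z‖ ^ 2 := by
    rw [hMid]
    refine (norm_add_le_max _ _).trans (max_le ((norm_add_le_max _ _).trans (max_le
      ((norm_add_le_max _ _).trans (max_le hK ?_)) hG)) ?_)
    · rw [norm_mul, hL12]
      have hBG : ‖B2 * z ^ 2 + G‖ ≤ ‖z‖ ^ 2 := by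
        refine (norm_add_le_max _ _).trans (max_le ?_ hG)
        rw [norm_mul, norm_pow]
        calc ‖B2‖ * ‖z‖ ^ 2 ≤ 1 * ‖z‖ ^ 2 := by gcongr
          _ = ‖z‖ ^ 2 := one_mul _
      calc ‖B2 * z ^ 2 + G‖ * ‖z‖ ^ 2 ≤ ‖z‖ ^ 2 * ‖z‖ ^ 2 := by gcongr
        _ ≤ 1 * ‖z‖ ^ 2 := by gcongr
        _ = ‖z‖ ^ 2 := one_mul _
    · rw [norm_mul, norm_mul, hC, mul_one]
      calc ‖X‖ * ‖D‖ ≤ ‖X‖ * ((p : ℝ) ^ 2 * ‖L‖ ^ 3) := by gcongr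
        _ = (p : ℝ) ^ 2 * (‖X‖ * ‖z‖ ^ 2) * (‖z‖ ^ 2 * ‖z‖ ^ 2) := by rw [hLn]; ring
        _ = ((p : ℝ) ^ 2 * ‖z‖ ^ 2) * ‖z‖ ^ 2 := by rw [hXz]; ring
        _ ≤ 1 * ‖z‖ ^ 2 := by gcongr
        _ = ‖z‖ ^ 2 := one_mul _
  -- Step F: the product and the end
  have hc1 : ‖c - 1‖ ≤ ‖L‖ := by
    obtain ⟨R, hR, hRle⟩ := coshOfSq_eq_one_add_half_add hp2 hLp
    rw [hcdef, hR, show 1 + L / 2 + R - 1 = L / 2 + R by ring]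
    refine (norm_add_le_max _ _).trans (max_le ?_ (hRle.trans ?_))
    · rw [div_eq_mul_inv, norm_mul, h2i, mul_one]
    · calc ‖L‖ * (p : ℝ)⁻¹ ≤ ‖L‖ * 1 := by gcongr; exact inv_le_one_of_one_le₀ hp1.le
        _ = ‖L‖ := mul_one _
  have hcn : ‖c‖ ≤ 1 := (norm_coshOfSq_eq_one hp2 hLp).le
  have hPr : ‖Pr - 1‖ ≤ ‖z‖ ^ 2 := by
    have hq1 : ‖q‖ ≤ 1 := hq.le
    refine (norm_tprod_tateSigmaSq_factor_sub_one_le_mul hq hcn).trans ?_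
    calc ‖q‖ * ‖c - 1‖ ≤ 1 * ‖L‖ := by gcongr
      _ = ‖z‖ ^ 2 := by rw [one_mul, hLn]
  have hMn : ‖M‖ ≤ 1 := by
    rw [show M = 1 + (M - 1) by ring]
    exact (norm_add_le_max _ _).trans (max_le (by simp) (hM1.trans hz2le1))
  have hfin : X * tateSigmaValueSq W p q x y - 1 = (M - 1) + M * (Pr - 1) := by
    rw [hSig, hMdef]; ring
  rw [hfin, hXinv]
  refine (norm_add_le_max _ _).trans (max_le hM1 ?_)
  rw [norm_mul]
  calc ‖M‖ * ‖Pr - 1‖ ≤ 1 * ‖z‖ ^ 2 := by gcongr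
    _ = ‖z‖ ^ 2 := one_mul _

end MainLarge



end Summit.BirchSwinnertonDyer.Rank1Residual.X11b.RegMult.HeightLogNumerator

end
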